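import Summits.BirchSwinnertonDyer.BirchSwinnertonDyer.Theorems.ByReductionTypeAtTwoAnalyticMuDepth
import Summits.BirchSwinnertonDyer.BirchSwinnertonDyer.Theorems.ByReductionTypeAtTwoKatoFreeSandwichOptimalTower
import Summits.BirchSwinnertonDyer.BirchSwinnertonDyer.Theorems.ByReductionTypeAtTwoOrdMissingLowerBoundAtTwoStubMaxPeriodWitness
import Literature.NumberTheory.EllipticCurves.ModularParametrizationBCDTProofs
import HarnessLib

/-!
# Route `ByReductionTypeAtTwo` (K4), crux `OrdMissingLowerBoundAtTwo` (stmt-BirchSwinnertonDyer-19577), line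
# `kato-free-lower-sandwich-two` — the research stub EQUIVALENT to «MEASURE DEPTH ⇒ PERIOD DESCENT» at the optimal
# curve (`--supports`, helper; prepares skeleton v6)

Cell `bsd-2adic`, lead `cruxlead-stmt-BirchSwinnertonDyer-19577` (g0).  THEOREMS ONLY — no definition, no named fact, no
`sorry`.  HONEST FRAMING: the crux 19577 is NOT closed and nothing research-grade is proved here; BSD is not proved by any of this.

WHAT.  With the landed pieces — the selector `stub_maxPeriodWitness` (p653776), `μ`-transport and the optimal-curve
re-centring (`…KatoFreeSandwichOptimalTower`, p655109), and S2's analytic half at every depth (`…AnalyticMuDepth`: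
`¬ AnalyticMuLE E₀ 2 s` ⟹ every doubled Mazur–Swinnerton-Dyer value `2μ_{f,α}(b + 2ⁿ⁺²ℤ₂)`, `b` odd, vanishes mod `2^{s+1}`,
modulo Abbes–Ullmo) — the registered research stub `stub_analyticMuLEAtMaxPeriod` of skeleton v5 («`AnalyticMuLE W″ 2 0` at
the member of maximal 2-adic real period») is EQUIVALENT, granted modularity (PUB's `nonempty_modularParametrizationData`,
turned into `exists_isNewformOf` by the tree's `exists_isNewformOf_of_nonempty_modularParametrizationData`) and Abbes–Ullmo, to the purely ARITHMETIC statement at the `X₀(N)`-optimal curve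

  «MEASURE DEPTH ⟹ PERIOD DESCENT»: if the MSD measure `μ_{f,α}` of the optimal curve `E₀` (newform `f = D₀.f`, unit root
  `α`) vanishes mod `2^{s+1}` on `ℤ₂^×` (all doubled values at odd classes), then some globally minimal `W₃ ∼ E₀` has
  `Ω(W₃) = r·Ω(E₀)` with `v₂(r) ≥ s + 1` — the class climbs at least `s+1` steps up the 2-adic period tower.

§2 `stubAtMaxPeriod_of_periodDescentOfMeasureDepth` (⇐) and §3 `periodDescentOfMeasureDepth_of_stubAtMaxPeriod` (⇒, using
the easy inequality «measure small ⟹ coefficients small»).  This is card #8's chain S2 (second half) ∘ S3 ∘ S4 compressed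
into ONE statement over tree vocabulary (`msdMeasure`, `ModularParametrizationData`, `realPeriodRat`), ready to be the
single research stub of skeleton v6.

References: B. Mazur, J. Tate, J. Teitelbaum, Invent. Math. 84 (1986), §I.10–I.13; R. Greenberg, LNM 1716 (1999), §5;
G. Stevens, Invent. Math. 98 (1989); W. Stein, M. Watkins, IMRN 2004:27, §3.
-/

set_option autoImplicit false
-- the sub-problem namespace repeats the summit name by design (D-0017 nested layout)
set_option linter.dupNamespace false

noncomputable section

open scoped Classical MatrixGroups ModularForm
open Filter Topology

open CongruenceSubgroup WeierstrassCurve Literature.NumberTheory.EllipticCurves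
  Literature.NumberTheory.EllipticCurves.ModularForms Literature.NumberTheory.EllipticCurves.Rank1Residual
  Literature.NumberTheory.EllipticCurves.Greenberg1999
  Summit.BirchSwinnertonDyer.Rank1Residual.X1.MuPart
  Summit.BirchSwinnertonDyer.Rank1Residual
  Summit.BirchSwinnertonDyer.BirchSwinnertonDyer.Theorems.IsogenyMuShift
  Summit.BirchSwinnertonDyer.BirchSwinnertonDyer.Theorems.AnalyticMuTwo

namespace Summit.BirchSwinnertonDyer.BirchSwinnertonDyer.Theorems.KatoFreeSandwich

/-! ## §1 Modularity

PUB (item 19149) carries modularity as `nonempty_modularParametrizationData`; the optimal-member theorem wants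
`exists_isNewformOf`.  The passage is the tree's
`Literature.NumberTheory.EllipticCurves.ModularForms.exists_isNewformOf_of_nonempty_modularParametrizationData`
(`ModularParametrizationBCDTProofs`), imported — not restated. -/

/-! ## §2 «Measure depth ⟹ period descent» implies the research stub -/

/-- **⇐.**  Granted modularity (`exists_isNewformOf`) and Abbes–Ullmo (`hAU`): IF at every `X₀(N)`-optimal, globally
minimal, non-CM, analytic-rank-`0`, good-ordinary-at-`2` curve `E₀` whose class has a member with rational `2`-torsion,
«all doubled MSD values of `μ_{D₀.f,α}` at odd classes vanish mod `2^{s+1}`» forces a globally minimal `W₃ ∼ E₀` with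
`v₂(Ω(W₃)/Ω(E₀)) ≥ s+1` (hypothesis `P`), THEN the registered stub holds: `AnalyticMuLE W″ 2 0` at every max-period member
`W″` of the class of a non-CM rank-`0` good-ordinary `W` with rational `2`-torsion.  Route: tower bound at `E₀`
(`stubAtMaxPeriod_of_optimalTowerBound`) by contradiction — `¬ AnalyticMuLE E₀ 2 t` ⟹ measure depth `t+1`
(`norm_two_mul_msdMeasure_le_of_not_analyticMuLE_of_optimal`, mod AU) ⟹ `P` ⟹ a member `t+1` steps up ⟹ contradicts the
maximality of `W″` (`t = v₂(Ω(W″)/Ω(E₀))`). [cite: GreenbergLNM1716, §5 p. 179 (shape)] [cite: AbbesUllmo1996, Thm. A] -/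
theorem stubAtMaxPeriod_of_periodDescentOfMeasureDepth (hnf : exists_isNewformOf)
    (hAU : abbesUllmo_not_dvd_maninConstant_of_not_dvd_level)
    (P : ∀ (E₀ : WeierstrassCurve ℚ) [E₀.IsElliptic] [E₀.IsGloballyMinimal] [NeZero (E₀.conductorNorm ℤ)]
      (D₀ : ModularParametrizationData E₀ (E₀.conductorNorm ℤ)),
      (∀ z ∈ D₀.L.lattice, ∃ w ∈ periodLattice D₀.f, z = D₀.c * w) →
      ¬ E₀.HasCM → E₀.analyticRank = 0 → GoodOrd E₀ 2 →
      (∃ (W₁ : WeierstrassCurve ℚ) (_ : W₁.IsElliptic) (_ : W₁.IsGloballyMinimal),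
        IsIsogenous E₀ W₁ ∧ ∃ x : ℚ, HasRationalTwoTorsionX W₁ x) →
      ∀ s : ℕ, (∀ (n : ℕ) (b : ZMod (2 ^ (n + 2))), ¬ 2 ∣ b.val →
        ‖2 * msdMeasure D₀.f (unitRoot E₀ 2 : ℚ_[2]) (n + 2) b‖ ≤ (2 : ℝ) ^ (-((s : ℤ) + 1))) →
      ∃ (W₃ : WeierstrassCurve ℚ) (_ : W₃.IsElliptic) (_ : W₃.IsGloballyMinimal),
        IsIsogenous E₀ W₃ ∧ ∃ r : ℚ, W₃.realPeriodRat = (r : ℝ) * E₀.realPeriodRat ∧ ((s : ℤ) + 1) ≤ padicValRat 2 r) :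
    ∀ (W W'' : WeierstrassCurve ℚ) [W.IsElliptic] [W.IsGloballyMinimal] [W''.IsElliptic] [W''.IsGloballyMinimal],
      ¬ W.HasCM → W.analyticRank = 0 → GoodOrd W 2 → IsIsogenous W W'' →
      (∃ x : ℚ, HasRationalTwoTorsionX W x) →
      (∀ (W₃ : WeierstrassCurve ℚ) [W₃.IsElliptic] [W₃.IsGloballyMinimal], IsIsogenous W'' W₃ →
        ∀ q : ℚ, W₃.realPeriodRat = (q : ℝ) * W''.realPeriodRat → padicValRat 2 q ≤ 0) →
      AnalyticMuLE W'' 2 0 := by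
  refine stubAtMaxPeriod_of_optimalTowerBound hnf ?_
  intro E₀ _ _ _ D₀ hopt hcm hr hgo hW₁ W'' _ _ hiso hmax r hrΩ
  haveI : Fact (Nat.Prime 2) := ⟨Nat.prime_two⟩
  by_contra hnot
  -- measure depth `t + 1`, `t = ⌊v₂ r⌋₊`
  have hdepth := norm_two_mul_msdMeasure_le_of_not_analyticMuLE_of_optimal E₀ hAU hgo D₀ hopt hnot
  obtain ⟨W₃, hE₃, hM₃, hiso₃, r₃, hr₃Ω, hv₃⟩ :=
    P E₀ D₀ hopt hcm hr hgo hW₁ (padicValRat 2 r).toNat (fun n b hb => hdepth n hb)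
  -- `Ω(W₃) = (r₃/r)·Ω(W″)`, and maximality of `W″`
  have hr0 : r ≠ 0 := by
    rintro rfl
    rw [Rat.cast_zero, zero_mul] at hrΩ
    exact (W''.realPeriodRat_pos_holds).ne' hrΩ
  have hr₃0 : r₃ ≠ 0 := by
    rintro rfl
    rw [Rat.cast_zero, zero_mul] at hr₃Ω
    exact (W₃.realPeriodRat_pos_holds).ne' hr₃Ω
  have hΩ₃ : W₃.realPeriodRat = ((r₃ / r : ℚ) : ℝ) * W''.realPeriodRat := by
    have hrR : (r : ℝ) ≠ 0 := by exact_mod_cast hr0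
    have h : ((r₃ / r : ℚ) : ℝ) * W''.realPeriodRat = (r₃ : ℝ) * E₀.realPeriodRat := by
      rw [hrΩ]; push_cast
      rw [div_mul_eq_mul_div, mul_comm (r : ℝ) _, ← mul_assoc, mul_div_assoc, div_self hrR, mul_one]
    rw [hr₃Ω, h]
  have hle := hmax W₃ ((hiso.symm_of_charZero).trans' hiso₃) (r₃ / r) hΩ₃
  rw [padicValRat.div hr₃0 hr0] at hle
  have ht := Int.self_le_toNat (padicValRat 2 r)
  omega

/-! ## §3 The converse: the research stub implies «measure depth ⟹ period descent» -/

section Converse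

variable {N : ℕ} [NeZero N] (f : CuspForm (Gamma0 N) 2) (α : ℚ_[2])

/-- **The easy inequality: measure small ⟹ coefficients small.**  If the distribution relation holds, `‖μ_{f,α}‖` is
bounded, and every doubled value on the exponent line has norm `≤ B`, then every coefficient `c_k` of `L₂(f,α,T)` has
norm `≤ B` (`c_k = lim_M RS(k,M)`, `RS(k,M) = Σ ν_M(s)·C(s,k)`). [cite: MazurTateTeitelbaum1986Invent, §I.11–I.13] -/
theorem norm_padicLCoeff_le_of_forall_norm_two_mul_msdMeasure_le
    (hdist : ∀ (n : ℕ) (a : ZMod (2 ^ n)),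
      ∑ b ∈ Finset.univ.filter (fun b : ZMod (2 ^ (n + 1)) ↦
        ZMod.castHom (pow_dvd_pow 2 n.le_succ) (ZMod (2 ^ n)) b = a), msdMeasure f α (n + 1) b =
        msdMeasure f α n a)
    (hμ : ∀ (m : ℕ) (a : ZMod (2 ^ m)), ‖msdMeasure f α m a‖ ≤ 2) {B : ℝ} (hB : 0 ≤ B)
    (hν : ∀ (m : ℕ) (s : ZMod (2 ^ m)),
      ‖2 * msdMeasure f α (m + 2) ((cyclotomicGenerator 2 : ZMod (2 ^ (m + 2))) ^ s.val)‖ ≤ B) (k : ℕ) :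
    ‖padicLCoeff f α k‖ ≤ B := by
  haveI : Fact (Nat.Prime 2) := ⟨Nat.prime_two⟩
  have hRS : ∀ m, ‖padicLRiemannSum f α k m‖ ≤ B := by
    intro m
    rw [padicLRiemannSum_two_eq_sum]
    refine IsUltrametricDist.norm_sum_le_of_forall_le_of_nonneg hB fun s _ => ?_
    rw [norm_mul]
    have hC1 : ‖((s.val.choose k : ℕ) : ℚ_[2])‖ ≤ 1 := by
      exact_mod_cast Padic.norm_int_le_one ((s.val.choose k : ℕ) : ℤ)
    calc _ ≤ B * 1 := mul_le_mul (hν m s) hC1 (norm_nonneg _) hB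
      _ = B := mul_one B
  exact le_of_tendsto (tendsto_padicLRiemannSum_of_norm_le hdist ⟨2, hμ⟩ k).norm
    (Filter.Eventually.of_forall hRS)

end Converse

/-- **⇒.**  The registered stub implies «measure depth ⟹ period descent» (granted Abbes–Ullmo for the unit `ϖ₀`): at an
optimal `E₀` as in the hypothesis, take the max-period member `W″` (`stub_maxPeriodWitness`) and `r = Ω(W″)/Ω(E₀)`
(`exists_rat_pos_realPeriodRat_eq_mul_of_isIsogenous`), `t = v₂ r`; the stub gives `AnalyticMuLE E₀ 2 t`
(`optimalTowerBound_of_stubAtMaxPeriod`), i.e. a coefficient of `ϖ₀·L₂` of norm `> 2^{-(t+1)}`; if the measure vanishes mod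
`2^{s+1}` then all coefficients have norm `≤ 2^{-(s+1)}` (§3, `‖ϖ₀‖ = 1`), so `s + 1 ≤ t` and `W₃ := W″` descends.
[cite: GreenbergLNM1716, §5 p. 179 (shape)] [cite: AbbesUllmo1996, Thm. A] -/
theorem periodDescentOfMeasureDepth_of_stubAtMaxPeriod (hAU : abbesUllmo_not_dvd_maninConstant_of_not_dvd_level)
    (hS : ∀ (W W'' : WeierstrassCurve ℚ) [W.IsElliptic] [W.IsGloballyMinimal] [W''.IsElliptic] [W''.IsGloballyMinimal],
      ¬ W.HasCM → W.analyticRank = 0 → GoodOrd W 2 → IsIsogenous W W'' →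
      (∃ x : ℚ, HasRationalTwoTorsionX W x) →
      (∀ (W₃ : WeierstrassCurve ℚ) [W₃.IsElliptic] [W₃.IsGloballyMinimal], IsIsogenous W'' W₃ →
        ∀ q : ℚ, W₃.realPeriodRat = (q : ℝ) * W''.realPeriodRat → padicValRat 2 q ≤ 0) →
      AnalyticMuLE W'' 2 0) :
    ∀ (E₀ : WeierstrassCurve ℚ) [E₀.IsElliptic] [E₀.IsGloballyMinimal] [NeZero (E₀.conductorNorm ℤ)]
      (D₀ : ModularParametrizationData E₀ (E₀.conductorNorm ℤ)),
      (∀ z ∈ D₀.L.lattice, ∃ w ∈ periodLattice D₀.f, z = D₀.c * w) →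
      ¬ E₀.HasCM → E₀.analyticRank = 0 → GoodOrd E₀ 2 →
      (∃ (W₁ : WeierstrassCurve ℚ) (_ : W₁.IsElliptic) (_ : W₁.IsGloballyMinimal),
        IsIsogenous E₀ W₁ ∧ ∃ x : ℚ, HasRationalTwoTorsionX W₁ x) →
      ∀ s : ℕ, (∀ (n : ℕ) (b : ZMod (2 ^ (n + 2))), ¬ 2 ∣ b.val →
        ‖2 * msdMeasure D₀.f (unitRoot E₀ 2 : ℚ_[2]) (n + 2) b‖ ≤ (2 : ℝ) ^ (-((s : ℤ) + 1))) →
      ∃ (W₃ : WeierstrassCurve ℚ) (_ : W₃.IsElliptic) (_ : W₃.IsGloballyMinimal),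
        IsIsogenous E₀ W₃ ∧ ∃ r : ℚ, W₃.realPeriodRat = (r : ℝ) * E₀.realPeriodRat ∧ ((s : ℤ) + 1) ≤ padicValRat 2 r := by
  intro E₀ _ _ _ D₀ hopt hcm hr hgo hW₁ s hν
  haveI : Fact (Nat.Prime 2) := ⟨Nat.prime_two⟩
  -- the max-period member and its ratio
  obtain ⟨W'', hE'', hM'', hiso, hmax⟩ := stub_maxPeriodWitness E₀
  obtain ⟨r, hrpos, hrΩ⟩ := exists_rat_pos_realPeriodRat_eq_mul_of_isIsogenous hiso
  refine ⟨W'', hE'', hM'', hiso, r, hrΩ, ?_⟩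
  -- the tower bound at `E₀`: a coefficient of `ϖ₀·L₂` of norm `> 2^{-(t+1)}`
  have hA : AnalyticMuLE E₀ 2 (padicValRat 2 r).toNat :=
    optimalTowerBound_of_stubAtMaxPeriod hS E₀ D₀ hopt hcm hr hgo hW₁ W'' hiso hmax r hrΩ
  -- the unit `ϖ₀ = 1/|c|` (Abbes–Ullmo) and the newform `D₀.f`
  have hord : IsOrdinaryAt E₀ 2 := hgo
  obtain ⟨hαeq, hαu, hα0⟩ := unitRoot_coe_spec (W := E₀) hord
  have hαinv : ‖(unitRoot E₀ 2 : ℚ_[2])⁻¹‖ ≤ 1 := by rw [norm_inv, hαu, inv_one]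
  have hf := D₀.isNewformOf
  have hQ : coeffField D₀.f = ⊥ := hf.coeffField_eq_bot
  have hreal : ∀ n, (cuspCoeff D₀.f n).im = 0 := cuspCoeff_im_eq_zero_of_coeffField_eq_bot hQ
  have hN2 : ¬ 2 ∣ E₀.conductorNorm ℤ := not_dvd_level_of_isNewformOf hf hord.1
  have ha₂ : cuspCoeff D₀.f 2 = ((E₀.frobeniusTrace 2 : ℤ) : ℂ) :=
    cuspCoeff_eq_frobeniusTrace_of_isNewformOf_holds hf hord.1
  have hplus : 0 < plusPeriod D₀.f := IsNewform0.plusPeriod_pos_holds hf.1 hQ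
  have hΩ : E₀.realPeriodRat = |(D₀.c : ℝ)| * plusPeriod D₀.f := D₀.realPeriodRat_eq_abs_mul_plusPeriod_of_latticeEq hopt
  have hc2 : ¬ ((2 : ℕ) : ℤ) ∣ D₀.maninConstant := hAU E₀ D₀ hopt 2 Nat.prime_two hN2
  set c' : ℤ := |D₀.c| with hc'
  have hc'2 : ¬ (2 : ℤ) ∣ c' := by rw [hc', dvd_abs]; exact_mod_cast hc2
  have hc'0 : (c' : ℝ) ≠ 0 := by
    intro h0
    have : c' = 0 := by exact_mod_cast h0
    rw [this] at hc'2
    exact hc'2 (dvd_zero _)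
  have hc'R : (c' : ℝ) = |(D₀.c : ℝ)| := by rw [hc']; push_cast; rfl
  -- `ϖ₀ := 1/c'` satisfies `ϖ₀·Ω(E₀) = Ω⁺_f` and is a unit
  have hϖΩ : (((c' : ℚ)⁻¹ : ℚ) : ℝ) * E₀.realPeriodRat = plusPeriod D₀.f := by
    rw [hΩ, ← hc'R]; push_cast; field_simp
  have hϖu : ‖(((c' : ℚ)⁻¹ : ℚ) : ℚ_[2])‖ = 1 := by
    have hcast : (((c' : ℚ)⁻¹ : ℚ) : ℚ_[2]) = ((c' : ℤ) : ℚ_[2])⁻¹ := by push_cast; rfl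
    rw [hcast, norm_inv]
    have hle : ‖((c' : ℤ) : ℚ_[2])‖ ≤ 1 := Padic.norm_int_le_one _
    have hnlt : ¬ ‖((c' : ℤ) : ℚ_[2])‖ < 1 := by
      rw [Padic.norm_intCast_lt_one_iff]; exact_mod_cast hc'2
    rw [le_antisymm hle (not_lt.mp hnlt), inv_one]
  -- all coefficients of `ϖ₀·L₂` are `≤ 2^{-(s+1)}`
  have hB0 : (0 : ℝ) ≤ (2 : ℝ) ^ (-((s : ℤ) + 1)) := zpow_nonneg (by norm_num) _
  have hc : ∀ k : ℕ, ‖padicLCoeff D₀.f (unitRoot E₀ 2 : ℚ_[2]) k‖ ≤ (2 : ℝ) ^ (-((s : ℤ) + 1)) := by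
    refine norm_padicLCoeff_le_of_forall_norm_two_mul_msdMeasure_le D₀.f _
      (msdMeasure_distribution_of_isNewformOf hord hf)
      (norm_msdMeasure_two_le_two_auto hf.1 hreal hN2 ha₂ hαinv hαeq) hB0 ?_
    intro m s₀
    -- the class `5^{s₀}` is odd
    refine hν m _ ?_
    have h5 : ¬ 2 ∣ ((cyclotomicGenerator 2 : ZMod (2 ^ (m + 2))) ^ s₀.val).val := by
      obtain ⟨u, hu⟩ := (isUnit_cyclotomicGenerator_cast (p := 2) (m + 2)).pow s₀.val
      rw [← hu]
      intro h2
      have hcop : Nat.gcd (u : ZMod (2 ^ (m + 2))).val (2 ^ (m + 2)) = 1 := ZMod.val_coe_unit_coprime u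
      have h21 : 2 ∣ Nat.gcd (u : ZMod (2 ^ (m + 2))).val (2 ^ (m + 2)) :=
        Nat.dvd_gcd h2 (dvd_pow_self 2 (by omega))
      rw [hcop] at h21
      exact absurd (Nat.le_of_dvd one_pos h21) (by omega)
    exact h5
  -- the witness coefficient of `AnalyticMuLE E₀ 2 t`
  obtain ⟨n, hn⟩ := hA D₀.f hf ((c' : ℚ)⁻¹) hϖΩ
  rw [PowerSeries.coeff_C_mul, coeff_padicLFunction, norm_mul, hϖu, one_mul] at hn
  have hlt : (2 : ℝ) ^ (-(((padicValRat 2 r).toNat : ℕ) + 1 : ℤ)) < (2 : ℝ) ^ (-((s : ℤ) + 1)) :=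
    lt_of_lt_of_le (by exact_mod_cast hn) (hc n)
  have hexp := (zpow_lt_zpow_iff_right₀ (by norm_num : (1 : ℝ) < 2)).mp hlt
  -- `v₂ r ≥ 0` (E₀ is a member; maximality of `W″`)
  have hr0 : r ≠ 0 := hrpos.ne'
  have hrΩ' : E₀.realPeriodRat = ((r⁻¹ : ℚ) : ℝ) * W''.realPeriodRat := by
    rw [hrΩ, Rat.cast_inv, ← mul_assoc, inv_mul_cancel₀ (by exact_mod_cast hr0), one_mul]
  have ht0 : 0 ≤ padicValRat 2 r := by
    have := hmax E₀ hiso.symm_of_charZero r⁻¹ hrΩ'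
    rwa [padicValRat.inv, neg_nonpos] at this
  rw [Int.toNat_of_nonneg ht0] at hexp
  omega

end Summit.BirchSwinnertonDyer.BirchSwinnertonDyer.Theorems.KatoFreeSandwich

end
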